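import Mathlib
import Summits.KontsevichZagierPeriods.Zeta5Search.SecondOrderRaise
import Summits.KontsevichZagierPeriods.Zeta5Search.KDigitCentre
import HarnessLib

/-!
# ζ(5) search — the `𝒦`-digit functional `ĉ` under the END RAISES `T ++ [1]` and `1 :: T` (DENOM-LAW D1, prover-d1 gen 15)

HONEST FRAMING: systematic search; no irrationality claim unless certified.  Cell `pub-zeta5`, track «DENOM-LAW» D1, seat `denom-prover-d1`
gen 15 (`denom-law/prover-d1/ATTEMPT-15.md` §5).  Companion of `KDigitCentre.lean` (`typeC`, `typeC2`, `cHat_of_rho_mul`, `cHat_centre_level`):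
the `ĉ`-analogues of typer g11's `typeW_snocOne` / `typeW_consOne` (`SecondOrderRaise.lean`), i.e. the two END RAISES of a type `T = (L, e)`:
* `typeC_snocOne` — `ĉ(T ++ [1]) = ĉ₂(T) − (L+1)·ĉ(T)` (new zero at level `L+1`: `Φ ↦ (η − (L+1))Φ`);
* `typeCCorr`, `typeC_consOne` — `ĉ(1 :: T) = ĉ₂(T) + ĉ(T) + corr_C(T)` with the TRANSLATION TERM
  `corr_C(T) = Σ_{poles i} ((2i²+3i+1)ρ_{i,1} + [n_i ≥ 2](4i+3)ρ_{i,2} + [n_i ≥ 3]·2ρ_{i,3}) = 2Σ(ρ₃ + 2iρ₂ + i²ρ₁) + 3Σ(ρ₂ + iρ₁) + Σρ₁`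
  — the three sums of gen-2 g9's `RhoResidueIdentities`, so `corr_C(T) = 2·[E(T) = −3]` for a REALISED class type with `E ≤ −3`;
* `typeC_end_pair` — the end-raise PAIR: `ĉ(T ++ [1]) + ĉ(1 :: T) = 2ĉ₂(T) − L·ĉ(T) + corr_C(T)`; with `ĉ(T) = 0` (palindrome of even exponent,
  `CHatReversal`) and `corr_C(T) = 0` this is `2·ĉ(centre class of T)` (`cHat_centre_level`) — the `𝒦`-half of the centre-companion identity
  `DenomLaw.CentreCompanionOdd`.
Pure finite-sum algebra over `ℚ`; nothing here bears on irrationality, no γ, nothing about ζ(5); records in print UNMOVED.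
-/

noncomputable section

open Finset PowerSeries

namespace Summit.KontsevichZagierPeriods.Zeta5Search.SecondOrder

open Summit.KontsevichZagierPeriods.Zeta5Search.LevelClass (typeRho)

/-! ## §1 A new end point: `ĉ(T ++ [1]) = ĉ₂(T) − (L+1) ĉ(T)` -/

/-- **`ĉ(T ++ [1]) = ĉ₂(T) − (L+1) ĉ(T)`.** -/
theorem typeC_snocOne (L : ℕ) (e : ℕ → ℤ) :
    typeC (L + 1) (snocOne e L) = typeC2 L e - ((L + 1 : ℕ) : ℚ) * typeC L e := by
  unfold typeC typeC2
  rw [sum_filter, sum_filter, sum_filter, mul_sum, ← sum_sub_distrib, sum_range_succ,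
    show snocOne e L (L + 1) = 1 by rw [snocOne, if_pos rfl], if_neg (by norm_num), add_zero]
  refine sum_congr rfl fun i hi => ?_
  have hiL : i ≤ L := by have := mem_range.1 hi; omega
  have hr : snocOne e L i = e i := by rw [snocOne, if_neg (by omega)]
  rw [hr]
  by_cases h0 : e i < 0
  · rw [if_pos h0, if_pos h0, if_pos h0, typeRho_snocOne e hiL (by push_cast; omega)]
    by_cases h2 : e i ≤ -2
    · rw [if_pos h2, if_pos h2, if_pos h2, if_pos (by push_cast; omega), typeRho_snocOne e hiL (by push_cast; omega)]
      by_cases h3 : e i ≤ -3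
      · rw [if_pos (by push_cast; omega), if_pos h3]; ring
      · rw [if_neg (by push_cast; omega), if_neg h3]; ring
    · rw [if_neg h2, if_neg h2, if_neg h2, if_neg (by push_cast; omega), if_neg (by omega)]; ring
  · rw [if_neg h0, if_neg h0, if_neg h0]; ring

/-! ## §2 A new first point: `ĉ(1 :: T) = ĉ₂(T) + ĉ(T) + corr_C(T)` -/

/-- The TRANSLATION TERM of `ĉ` under `T ↦ 1 :: T` (levels shift by one):
`corr_C(T) = Σ_{poles i} ((2i²+3i+1)ρ_{i,1} + [n_i ≥ 2](4i+3)ρ_{i,2} + [n_i ≥ 3] 2ρ_{i,3})`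
`= 2Σ(ρ₃ + 2iρ₂ + i²ρ₁) + 3Σ(ρ₂ + iρ₁) + Σρ₁` (the three residue sums of `RhoResidueIdentities`). -/
def typeCCorr (L : ℕ) (e : ℕ → ℤ) : ℚ :=
  ∑ i ∈ (range (L + 1)).filter (fun i => e i < 0),
    ((2 * (((i : ℕ) : ℚ)) ^ 2 + 3 * ((i : ℕ) : ℚ) + 1) * typeRho L e i 1
      + (if e i ≤ -2 then (4 * ((i : ℕ) : ℚ) + 3) * typeRho L e i 2 else 0)
      + (if e i ≤ -3 then 2 * typeRho L e i 3 else 0))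

/-- **`ĉ(1 :: T) = ĉ₂(T) + ĉ(T) + corr_C(T)`.** -/
theorem typeC_consOne (L : ℕ) (e : ℕ → ℤ) :
    typeC (L + 1) (consOne e) = typeC2 L e + typeC L e + typeCCorr L e := by
  unfold typeC typeC2 typeCCorr
  rw [sum_filter, sum_filter, sum_filter, sum_filter, ← sum_add_distrib, ← sum_add_distrib, sum_range_succ',
    show consOne e 0 = 1 by rw [consOne, if_pos rfl], if_neg (by norm_num), add_zero]
  refine sum_congr rfl fun i hi => ?_
  have hr : consOne e (i + 1) = e i := by rw [consOne, if_neg (by omega), Nat.add_sub_cancel]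
  rw [hr]
  by_cases h0 : e i < 0
  · rw [if_pos h0, if_pos h0, if_pos h0, if_pos h0, typeRho_consOne e i (by push_cast; omega)]
    by_cases h2 : e i ≤ -2
    · rw [if_pos h2, if_pos h2, if_pos h2, if_pos h2, if_pos (by push_cast; omega), typeRho_consOne e i (by push_cast; omega)]
      by_cases h3 : e i ≤ -3
      · rw [if_pos (by push_cast; omega), if_pos h3, if_pos h3]; push_cast; ring
      · rw [if_neg (by push_cast; omega), if_neg h3, if_neg h3]; push_cast; ring
    · rw [if_neg h2, if_neg h2, if_neg h2, if_neg h2, if_neg (by push_cast; omega), if_neg (by omega), if_neg (by omega)]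
      push_cast; ring
  · rw [if_neg h0, if_neg h0, if_neg h0, if_neg h0]; ring

/-! ## §3 The end-raise pair -/

/-- **The END-RAISE PAIR**: `ĉ(T ++ [1]) + ĉ(1 :: T) = 2ĉ₂(T) − L·ĉ(T) + corr_C(T)`.  (For a palindromic `T` of even exponent, `ĉ(T) = 0`, and for
a realised class type with `E ≤ −4`, `corr_C(T) = 0`; the right-hand side is then `2·(ĉ₂(T) − (L/2)ĉ(T))`, twice the `ĉ` of the odd-centre class
of type `T` — `KDigitCentre.cHat_centre_level`.) -/
theorem typeC_end_pair (L : ℕ) (e : ℕ → ℤ) :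
    typeC (L + 1) (snocOne e L) + typeC (L + 1) (consOne e) = 2 * typeC2 L e - (L : ℚ) * typeC L e + typeCCorr L e := by
  rw [typeC_snocOne, typeC_consOne]; push_cast; ring

end Summit.KontsevichZagierPeriods.Zeta5Search.SecondOrder

end
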